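import Summits.RiemannHypothesis.RiemannHypothesis.Theorems.EtaLeadingQuarterSecondMomentZerosAssembly
import Summits.RiemannHypothesis.RiemannHypothesis.Theorems.EtaLeadingQuarterSecondMomentZerosError
import Literature.NumberTheory.LFunctions.MontgomeryZeroSideProofs
import Literature.NumberTheory.Sieve.HeathBrownCubicLeadingB
import HarnessLib

/-!
# The second moment of the sharp eta vector at the zeros, zero side X: the `ε`-closer modulo the
# per-zero AFE engine (route EtaLeadingQuarter, item `EtaLeadingSecondMoment`, stmt-RiemannHypothesis-21791)

`γ_n = zetaOrdinate n`, `N(T) = zetaZeroCount T`, `T_M(s) = ∑_{m≤M} (−1)^m m^{-s}`,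
`S(y,t) = ∑_{k odd ≤ y} k^{-1/2} k^{-it}`, `d_n = |γ_n/(πM) − round(γ_n/(πM))|`.

`even_bound_of_engine`: the bound of `EtaLeadingSecondMoment` (item 21791) ALONG THE EVEN `M`,
`∀ ε > 0, ∀ᶠ M, M even → M · Z_M ≤ (1/4 + ε) log M`, follows from the PER-ZERO ENGINE at the zeros
`1/2 + iγ_n`, `4⌊M/2⌋ < γ_n ≤ M²`, `M` even (the odd `M` are reduced to the even ones in part XI):

  `∃ q ≥ 0, ∀ η ∈ (0, 1/2], ∃ c ≥ 0, ∀ᶠ M, M even → ∀ n ∈ [N(4⌊M/2⌋), N(M²)),`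
  `  ‖T_M(1/2+iγ_n)‖ ≤ √2 ‖S(⌊γ_n/(πM)⌋, γ_n)‖ + (c (1+log M)/√M + 1_{d_n ≤ η} q √(M/γ_n))`

(the unbalanced Hardy–Littlewood AFE with a gap `η` off the transition zones and the crude bound
inside them; sibling files `…SecondMomentAFE*`, `…EtaLeadingSecondMomentMainTerm`). Bookkeeping:
`Zeros.assembly_core` (small heights `576 B₀`, dual main term `(1+θ)(log M/4 + …)`, high bands) and
`Zeros.error_sum_le` (`2(1+1/θ)[2p² M G(4⌊M/2⌋) + 2q² A log(M²+πM+3)(2η+1/M)]`), with `θ = min(1,ε)`,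
`η ≍ ε/((1+1/θ)(q²A+1))`, and every remaining term `≤ K (1+log M)⁴/M → 0`.
RH enters through the engine and Landau's formula. Nothing here bears on the truth of RH: the
conclusion is one input of a rung route onto the RH-free leaf `ScrewFloorLimsupQuarter`.
-/

noncomputable section

open Real Finset Filter Topology Complex

set_option linter.dupNamespace false  -- the mandated namespace repeats `RiemannHypothesis`

namespace Summit.RiemannHypothesis.RiemannHypothesis.Theorems.EtaLeadingQuarter.Zeros

open Literature.NumberTheory.LFunctions NicolasJExplicit SchoenfeldBound ZeroSide

/-! ## Elementary growth bookkeeping -/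

/-- `(1 + L)⁴ ≤ 16 (1 + L⁴)` for `L ≥ 0` (indeed `≤ 8(1+L⁴)`, `= ` at `L = 1`). [folklore] -/
theorem one_add_pow_four_le {L : ℝ} (hL : 0 ≤ L) : (1 + L) ^ 4 ≤ 16 * (1 + L ^ 4) := by
  nlinarith [mul_nonneg (sq_nonneg (L - 1)) (by positivity : (0 : ℝ) ≤ 7 * L ^ 2 + 10 * L + 7),
    pow_nonneg hL 4]

/-- `(1 + log M)⁴/M → 0` along the naturals. [folklore] -/
theorem tendsto_log_pow_four_div :
    Tendsto (fun M : ℕ ↦ (1 + Real.log (M : ℝ)) ^ 4 / (M : ℝ)) atTop (𝓝 0) := by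
  have h1 : Tendsto (fun x : ℝ ↦ Real.log x ^ 4 / x) atTop (𝓝 0) := by
    simpa using Real.tendsto_pow_log_div_mul_add_atTop 1 0 4 one_ne_zero
  have h2 : Tendsto (fun x : ℝ ↦ x⁻¹) atTop (𝓝 0) := tendsto_inv_atTop_zero
  have h3 : Tendsto (fun x : ℝ ↦ 16 * x⁻¹ + 16 * (Real.log x ^ 4 / x)) atTop (𝓝 0) := by
    simpa using (h2.const_mul 16).add (h1.const_mul 16)
  have h4 := h3.comp tendsto_natCast_atTop_atTop
  refine squeeze_zero' (Eventually.of_forall fun M ↦ by positivity) ?_ h4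
  filter_upwards [eventually_ge_atTop 1] with M hM
  have hM0 : (0 : ℝ) < M := by exact_mod_cast hM
  have hL : 0 ≤ Real.log (M : ℝ) := Real.log_nonneg (by exact_mod_cast hM)
  simp only [Function.comp]
  rw [show (16 : ℝ) * ((M : ℝ))⁻¹ + 16 * (Real.log M ^ 4 / M) = 16 * (1 + Real.log M ^ 4) / M by
    field_simp]
  exact div_le_div_of_nonneg_right (one_add_pow_four_le hL) hM0.le

/-- For `M ≥ 2`: `log(M² + πM + 3) ≤ 2(1 + log M)`, `log(M+1) ≤ 1 + log M`, `log(M²) = 2 log M`,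
`log(4⌊M/2⌋) ≤ 1 + log M`. [folklore] -/
theorem log_bounds {M : ℕ} (hM : 2 ≤ M) :
    Real.log ((M : ℝ) ^ 2 + π * M + 3) ≤ 2 * (1 + Real.log M) ∧
      Real.log ((M : ℝ) + 1) ≤ 1 + Real.log M ∧ Real.log ((M : ℝ) ^ 2) = 2 * Real.log M ∧
      Real.log (4 * ((M / 2 : ℕ) : ℝ)) ≤ 1 + Real.log M := by
  have hMr : (2 : ℝ) ≤ M := by exact_mod_cast hM
  have hM0 : (0 : ℝ) < M := by linarith
  have hπ4 := Real.pi_lt_d2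
  have hlog2 := Real.log_two_lt_d9
  refine ⟨?_, ?_, ?_, ?_⟩
  · have h1 : (M : ℝ) ^ 2 + π * M + 3 ≤ 6 * (M : ℝ) ^ 2 := by nlinarith
    calc Real.log ((M : ℝ) ^ 2 + π * M + 3) ≤ Real.log (6 * (M : ℝ) ^ 2) :=
          Real.log_le_log (by positivity) h1
      _ = Real.log 6 + 2 * Real.log M := by rw [Real.log_mul (by norm_num) (by positivity), Real.log_pow]; push_cast; ring
      _ ≤ 2 * (1 + Real.log M) := by linarith [Literature.NumberTheory.Sieve.CubicSieve.log_six_le_two]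
  · calc Real.log ((M : ℝ) + 1) ≤ Real.log (2 * M) := Real.log_le_log (by positivity) (by linarith)
      _ = Real.log 2 + Real.log M := Real.log_mul (by norm_num) hM0.ne'
      _ ≤ 1 + Real.log M := by linarith
  · rw [Real.log_pow]; push_cast; ring
  · have hK : ((M / 2 : ℕ) : ℝ) ≤ (M : ℝ) / 2 := by
      have : 2 * (M / 2) ≤ M := Nat.mul_div_le M 2
      have : ((2 * (M / 2) : ℕ) : ℝ) ≤ M := by exact_mod_cast this
      push_cast at this; linarith
    have hK1 : (1 : ℝ) ≤ ((M / 2 : ℕ) : ℝ) := by exact_mod_cast (show 1 ≤ M / 2 by omega)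
    calc Real.log (4 * ((M / 2 : ℕ) : ℝ)) ≤ Real.log (2 * M) := Real.log_le_log (by positivity) (by linarith)
      _ = Real.log 2 + Real.log M := Real.log_mul (by norm_num) hM0.ne'
      _ ≤ 1 + Real.log M := by linarith

/-- `M · G(4⌊M/2⌋) ≤ 25 (1 + log M)` for `M ≥ 1260` (`G = SchoenfeldBound.Gtail`). [folklore] -/
theorem mul_Gtail_le {M : ℕ} (hM : 1260 ≤ M) :
    (M : ℝ) * Gtail (4 * ((M / 2 : ℕ) : ℝ)) ≤ 25 * (1 + Real.log M) := by
  have hMr : (1260 : ℝ) ≤ M := by exact_mod_cast hM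
  have hK : (630 : ℝ) ≤ ((M / 2 : ℕ) : ℝ) := by exact_mod_cast (show 630 ≤ M / 2 by omega)
  have hK2 : (M : ℝ) - 1 ≤ 2 * ((M / 2 : ℕ) : ℝ) := by
    have : M ≤ 2 * (M / 2) + 1 := by omega
    have : (M : ℝ) ≤ ((2 * (M / 2) + 1 : ℕ) : ℝ) := by exact_mod_cast this
    push_cast at this; linarith
  set T : ℝ := 4 * ((M / 2 : ℕ) : ℝ) with hT
  have hT2516 : 2516 ≤ T := by rw [hT]; linarith
  have hTM : (M : ℝ) ≤ T := by rw [hT]; linarith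
  have hT0 : 0 < T := by linarith
  obtain ⟨-, -, -, hlogT⟩ := log_bounds (show 2 ≤ M by omega)
  have hL0 : 0 ≤ Real.log T := Real.log_nonneg (by linarith)
  have hLM : 0 ≤ Real.log (M : ℝ) := Real.log_nonneg (by linarith)
  have hG := Gtail_le_log hT2516
  -- `M (log T + 1)/(2πT) ≤ (log T + 1)/(2π) ≤ log T + 1` and `M · 23 log T/T² ≤ 23 log T/T ≤ log T`
  have h1 : (M : ℝ) * ((Real.log T + 1) / (2 * π * T)) ≤ Real.log T + 1 := by
    rw [mul_div_assoc', div_le_iff₀ (by positivity)]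
    have hπ1 : (1 : ℝ) ≤ 2 * π := by linarith [Real.pi_gt_three]
    calc (M : ℝ) * (Real.log T + 1) ≤ T * (Real.log T + 1) := mul_le_mul_of_nonneg_right hTM (by positivity)
      _ = (Real.log T + 1) * (1 * T) := by ring
      _ ≤ (Real.log T + 1) * (2 * π * T) :=
          mul_le_mul_of_nonneg_left (mul_le_mul_of_nonneg_right hπ1 hT0.le) (by positivity)
  have h2 : (M : ℝ) * (23 * Real.log T / T ^ 2) ≤ Real.log T := by
    rw [mul_div_assoc', div_le_iff₀ (by positivity)]
    nlinarith [mul_le_mul_of_nonneg_left hTM hL0, mul_le_mul_of_nonneg_left hT2516 hL0]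
  calc (M : ℝ) * Gtail T ≤ (M : ℝ) * ((Real.log T + 1) / (2 * π * T) + 23 * Real.log T / T ^ 2) :=
        mul_le_mul_of_nonneg_left hG (by positivity)
    _ ≤ Real.log T + 1 + Real.log T := by rw [mul_add]; exact add_le_add h1 h2
    _ ≤ 25 * (1 + Real.log M) := by nlinarith

/-! ## Pure arithmetic of the three pieces (small contexts) -/

/-- Main term: `(1+θ)(lM/4 + C₁ + C₂ Y/M) ≤ lM/4 + (ε/4) lM + 2C₁ + 32 C₂ L4` when `θ ≤ min(1,ε)`,
`Y/M ≤ 16 L4`. [folklore] -/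
theorem arith_main {θ ε lM C₁ C₂ Y M L4 : ℝ} (hθ1 : θ ≤ 1) (hθε : θ ≤ ε) (hlM : 0 ≤ lM)
    (hC₁ : 0 ≤ C₁) (hC₂ : 0 ≤ C₂) (hM : 0 < M) (hY0 : 0 ≤ Y) (hY : Y ≤ 16 * (L4 * M)) :
    (1 + θ) * (lM / 4 + C₁ + C₂ * Y / M) ≤ lM / 4 + ε / 4 * lM + 2 * C₁ + 32 * C₂ * L4 := by
  have hYM : Y / M ≤ 16 * L4 := by rw [div_le_iff₀ hM]; linarith
  have hYM0 : 0 ≤ Y / M := div_nonneg hY0 hM.le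
  have e : (1 + θ) * (lM / 4 + C₁ + C₂ * Y / M) =
      lM / 4 + C₁ + C₂ * (Y / M) + θ * (lM / 4) + θ * C₁ + θ * (C₂ * (Y / M)) := by ring
  rw [e]
  nlinarith [mul_le_mul_of_nonneg_right hθε hlM, mul_le_mul_of_nonneg_left hYM hC₂,
    mul_le_mul_of_nonneg_right hθ1 (mul_nonneg hC₂ hYM0), mul_le_mul_of_nonneg_right hθ1 hC₁]

/-- Error term: from `Serr ≤ 2 (c²L₁²/M) MG + 2 q² (A LQ (2η + 1/M))`, `MG ≤ 25 L₁`, `LQ ≤ 2 L₁`,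
`8 t q² A η ≤ ε/4`: `t Serr ≤ (ε/4)(L₁ − 1) + ε/4 + (50 t c² + 4 t q² A) L₁⁴/M`. [folklore] -/
theorem arith_err {t c L₁ M MG q A LQ η ε Serr : ℝ} (ht : 0 ≤ t) (hA : 0 ≤ A) (hM : 1 ≤ M)
    (hL₁ : 1 ≤ L₁) (hMG : MG ≤ 25 * L₁) (hLQ : LQ ≤ 2 * L₁) (hη0 : 0 ≤ η)
    (hηε : 8 * t * (q ^ 2 * A) * η ≤ ε / 4)
    (herr : Serr ≤ 2 * (c ^ 2 * L₁ ^ 2 / M) * MG + 2 * q ^ 2 * (A * LQ * (2 * η + 1 / M))) :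
    t * Serr ≤ ε / 4 * (L₁ - 1) + ε / 4 + (50 * t * c ^ 2 + 4 * t * (q ^ 2 * A)) * (L₁ ^ 4 / M) := by
  have hM0 : 0 < M := by linarith
  have hL0 : 0 ≤ L₁ := by linarith
  have hL3 : L₁ ^ 2 * L₁ ≤ L₁ ^ 4 := by rw [← pow_succ]; exact pow_le_pow_right₀ hL₁ (by norm_num)
  have hL4 : L₁ ≤ L₁ ^ 4 := le_self_pow₀ hL₁ (by norm_num)
  have e1 : 2 * (c ^ 2 * L₁ ^ 2 / M) * MG ≤ 50 * c ^ 2 * (L₁ ^ 4 / M) := by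
    calc 2 * (c ^ 2 * L₁ ^ 2 / M) * MG ≤ 2 * (c ^ 2 * L₁ ^ 2 / M) * (25 * L₁) :=
          mul_le_mul_of_nonneg_left hMG (by positivity)
      _ = 50 * c ^ 2 * (L₁ ^ 2 * L₁ / M) := by ring
      _ ≤ 50 * c ^ 2 * (L₁ ^ 4 / M) := by gcongr
  have e2 : 2 * q ^ 2 * (A * LQ * (2 * η + 1 / M)) ≤
      8 * (q ^ 2 * A) * η * L₁ + 4 * (q ^ 2 * A) * (L₁ ^ 4 / M) := by
    calc 2 * q ^ 2 * (A * LQ * (2 * η + 1 / M)) ≤ 2 * q ^ 2 * (A * (2 * L₁) * (2 * η + 1 / M)) := by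
          gcongr
      _ = 8 * (q ^ 2 * A) * η * L₁ + 4 * (q ^ 2 * A) * (L₁ / M) := by ring
      _ ≤ 8 * (q ^ 2 * A) * η * L₁ + 4 * (q ^ 2 * A) * (L₁ ^ 4 / M) := by gcongr
  have e3 : t * (8 * (q ^ 2 * A) * η * L₁) ≤ ε / 4 * L₁ := by
    have : t * (8 * (q ^ 2 * A) * η * L₁) = (8 * t * (q ^ 2 * A) * η) * L₁ := by ring
    rw [this]
    exact mul_le_mul_of_nonneg_right hηε hL0
  calc t * Serr ≤ t * (2 * (c ^ 2 * L₁ ^ 2 / M) * MG + 2 * q ^ 2 * (A * LQ * (2 * η + 1 / M))) :=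
        mul_le_mul_of_nonneg_left herr ht
    _ ≤ t * (50 * c ^ 2 * (L₁ ^ 4 / M) + (8 * (q ^ 2 * A) * η * L₁ + 4 * (q ^ 2 * A) * (L₁ ^ 4 / M))) :=
        mul_le_mul_of_nonneg_left (add_le_add e1 e2) ht
    _ = t * (8 * (q ^ 2 * A) * η * L₁) + (50 * t * c ^ 2 + 4 * t * (q ^ 2 * A)) * (L₁ ^ 4 / M) := by ring
    _ ≤ ε / 4 * L₁ + (50 * t * c ^ 2 + 4 * t * (q ^ 2 * A)) * (L₁ ^ 4 / M) := by linarith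
    _ = ε / 4 * (L₁ - 1) + ε / 4 + (50 * t * c ^ 2 + 4 * t * (q ^ 2 * A)) * (L₁ ^ 4 / M) := by ring

/-- High bands at `T₂ = M²`: `M · 432A(1 + log M²)(M² + M)M^{-4}(3/2 + log²M/2)(1 + log(M+1)) ≤ 6912 A L₁⁴/M`
(`L₁ = 1 + log M`, `M ≥ 2`). [folklore] -/
theorem arith_hb {A : ℝ} (hA : 0 ≤ A) {M : ℕ} (hM : 2 ≤ M) :
    (M : ℝ) * (432 * A * (1 + Real.log ((M : ℝ) ^ 2)) * ((M : ℝ) ^ 2 + M) / ((M : ℝ) ^ 2) ^ 2 *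
      ((3 / 2 + Real.log M ^ 2 / 2) * (1 + Real.log ((M : ℝ) + 1)))) ≤
      6912 * A * ((1 + Real.log M) ^ 4 / M) := by
  obtain ⟨-, hlogM1, hlogM2, -⟩ := log_bounds hM
  have hMr : (2 : ℝ) ≤ M := by exact_mod_cast hM
  have hMpos : (0 : ℝ) < M := by linarith
  have hLM : 0 ≤ Real.log (M : ℝ) := Real.log_nonneg (by linarith)
  set L₁ : ℝ := 1 + Real.log M with hL₁
  rw [hlogM2]
  have h1 : 1 + 2 * Real.log (M : ℝ) ≤ 2 * L₁ := by rw [hL₁]; linarith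
  have h2 : (M : ℝ) * (((M : ℝ) ^ 2 + M) / ((M : ℝ) ^ 2) ^ 2) ≤ 2 / M := by
    rw [mul_div_assoc', div_le_div_iff₀ (by positivity) hMpos]; nlinarith
  have h3 : 3 / 2 + Real.log (M : ℝ) ^ 2 / 2 ≤ 2 * L₁ ^ 2 := by rw [hL₁]; nlinarith
  have h4 : 1 + Real.log ((M : ℝ) + 1) ≤ 2 * L₁ := by rw [hL₁]; linarith
  have hL0 : 0 ≤ L₁ := by rw [hL₁]; linarith
  have hlog1 : 0 ≤ 1 + Real.log ((M : ℝ) + 1) := by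
    have : 0 ≤ Real.log ((M : ℝ) + 1) := Real.log_nonneg (by linarith)
    linarith
  calc (M : ℝ) * (432 * A * (1 + 2 * Real.log (M : ℝ)) * ((M : ℝ) ^ 2 + M) / ((M : ℝ) ^ 2) ^ 2 *
        ((3 / 2 + Real.log M ^ 2 / 2) * (1 + Real.log ((M : ℝ) + 1))))
      = 432 * A * (1 + 2 * Real.log (M : ℝ)) * ((M : ℝ) * (((M : ℝ) ^ 2 + M) / ((M : ℝ) ^ 2) ^ 2)) *
        ((3 / 2 + Real.log M ^ 2 / 2) * (1 + Real.log ((M : ℝ) + 1))) := by ring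
    _ ≤ 432 * A * (2 * L₁) * (2 / M) * ((2 * L₁ ^ 2) * (2 * L₁)) := by
        gcongr
    _ = 6912 * A * (L₁ ^ 4 / M) := by ring

/-! ## The closer modulo the engine -/

/-- **The even-`M` bound of `EtaLeadingSecondMoment` from the per-zero AFE engine.** Under RH, if
there are `q ≥ 0` and for every `η ∈ (0, 1/2]` a `c ≥ 0` with, for all large EVEN `M` and all `n`
with `4⌊M/2⌋ < γ_n ≤ M²`,
`‖T_M(1/2+iγ_n)‖ ≤ √2 ‖S(⌊γ_n/(πM)⌋, γ_n)‖ + (c(1+log M)/√M + 1_{d_n ≤ η} q √(M/γ_n))`, then for every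
`ε > 0`, eventually in `M`: `M even → M ∑_ρ m γ^{-2} ‖V_M(γ)‖² ≤ (1/4 + ε) log M`. [folklore] -/
theorem even_bound_of_engine (hRH : RiemannHypothesis)
    (hEng : ∃ q : ℝ, 0 ≤ q ∧ ∀ η : ℝ, 0 < η → η ≤ 1 / 2 → ∃ c : ℝ, 0 ≤ c ∧
      ∀ᶠ M : ℕ in atTop, Even M → ∀ n ∈ Finset.Ico (zetaZeroCount (4 * ((M / 2 : ℕ) : ℝ))) (zetaZeroCount ((M : ℝ) ^ 2)),
        ‖∑ m ∈ Finset.Icc 1 M, (-1 : ℂ) ^ m * (m : ℂ) ^ (-((1 / 2 : ℂ) + (zetaOrdinate n : ℂ) * I))‖ ≤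
          Real.sqrt 2 * ‖∑ k ∈ (Finset.Icc 1 ⌊zetaOrdinate n / (π * M)⌋₊).filter Odd,
              (((1 / Real.sqrt k : ℝ)) : ℂ) * (k : ℂ) ^ (-((zetaOrdinate n : ℂ) * I))‖ +
            (c * (1 + Real.log M) / Real.sqrt M +
              (if |zetaOrdinate n / (π * M) - round (zetaOrdinate n / (π * M))| ≤ η then
                q * Real.sqrt (M / zetaOrdinate n) else 0))) {ε : ℝ} (hε : 0 < ε) :
    ∀ᶠ M : ℕ in atTop, Even M →
      (M : ℝ) * ∑' ρ : Zeros, (riemannZetaZeroOrder (ρ : ℂ) : ℝ) / (ρ : ℂ).im ^ 2 *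
          ‖-1 + ∑ m ∈ Finset.Icc 2 M, ((((-1 : ℝ) ^ m * (m : ℝ) ^ (-(1 / 2 : ℝ))) : ℝ) : ℂ) *
            (m : ℂ) ^ ((((ρ : ℂ).im : ℝ) : ℂ) * I)‖ ^ 2 ≤ (1 / 4 + ε) * Real.log M := by
  obtain ⟨A, hApos, hA⟩ := Montgomery.exists_zetaZeroCount_add_one_sub_le
  have hA0 : 0 ≤ A := hApos.le
  obtain ⟨C₁, C₂, hC₁, hC₂, hcore⟩ := assembly_core hRH hA0 hA
  obtain ⟨q, hq, hEng'⟩ := hEng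
  -- parameters
  obtain ⟨θ, hθ0, hθ1, hθε⟩ : ∃ θ : ℝ, 0 < θ ∧ θ ≤ 1 ∧ θ ≤ ε :=
    ⟨min 1 ε, lt_min one_pos hε, min_le_left _ _, min_le_right _ _⟩
  set t : ℝ := 2 * (1 + 1 / θ) with ht
  have ht0 : 0 ≤ t := by positivity
  have hW : 0 < 32 * t * (q ^ 2 * A + 1) := by positivity
  obtain ⟨η, hη0, hη2, hηε⟩ : ∃ η : ℝ, 0 < η ∧ η ≤ 1 / 2 ∧ 8 * t * (q ^ 2 * A) * η ≤ ε / 4 := by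
    refine ⟨min (1 / 2) (ε / (32 * t * (q ^ 2 * A + 1))), lt_min (by norm_num) (div_pos hε hW),
      min_le_left _ _, ?_⟩
    have h1 : min (1 / 2) (ε / (32 * t * (q ^ 2 * A + 1))) ≤ ε / (32 * t * (q ^ 2 * A + 1)) := min_le_right _ _
    have h2 : 8 * t * (q ^ 2 * A) * (ε / (32 * t * (q ^ 2 * A + 1))) ≤ ε / 4 := by
      rw [mul_div_assoc', div_le_div_iff₀ hW (by norm_num)]
      nlinarith [mul_nonneg (mul_nonneg ht0 (mul_nonneg (sq_nonneg q) hA0)) hε.le]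
    exact le_trans (mul_le_mul_of_nonneg_left h1 (by positivity)) h2
  obtain ⟨c, hc, hEng''⟩ := hEng' η hη0 hη2
  -- the constants
  set B₀ : ℝ := ∑' ρ : Zeros, (riemannZetaZeroOrder (ρ : ℂ) : ℝ) / (ρ : ℂ).im ^ 2 with hB₀
  set K : ℝ := 32 * C₂ + (50 * t * c ^ 2 + 4 * t * (q ^ 2 * A)) + 6912 * A with hK
  -- eventually: engine, size, junk ≤ 1, constants ≤ (ε/2) log M
  have hlogM : Tendsto (fun M : ℕ ↦ Real.log (M : ℝ)) atTop atTop :=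
    Real.tendsto_log_atTop.comp tendsto_natCast_atTop_atTop
  have hjunk : ∀ᶠ M : ℕ in atTop, K * ((1 + Real.log (M : ℝ)) ^ 4 / M) ≤ 1 := by
    have h := tendsto_log_pow_four_div.const_mul K
    rw [mul_zero] at h
    exact h.eventually (ge_mem_nhds zero_lt_one)
  filter_upwards [hEng'', eventually_ge_atTop 1260, hjunk,
    hlogM.eventually_ge_atTop ((576 * B₀ + 2 * C₁ + ε / 4 + 1) / (ε / 2))] with M hEM hM hjM hlogM' hEven
  have hMr : (1260 : ℝ) ≤ M := by exact_mod_cast hM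
  have hMpos : (0 : ℝ) < M := by linarith
  have hM1 : (1 : ℝ) ≤ M := by linarith
  have hLM : 0 ≤ Real.log (M : ℝ) := Real.log_nonneg hM1
  have hL₁1 : 1 ≤ 1 + Real.log (M : ℝ) := by linarith
  obtain ⟨hlogQ, -, hlogM2, -⟩ := log_bounds (show 2 ≤ M by omega)
  -- `T₂ = M²`
  have hT₂lo : 4 * ((M / 2 : ℕ) : ℝ) ≤ (M : ℝ) ^ 2 := by
    have : ((M / 2 : ℕ) : ℝ) ≤ M := by exact_mod_cast Nat.div_le_self M 2
    nlinarith
  have hT₂ : (2516 : ℝ) ≤ (M : ℝ) ^ 2 := by nlinarith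
  -- the error sequence
  set E : ℕ → ℝ := fun n ↦ c * (1 + Real.log M) / Real.sqrt M +
    (if |zetaOrdinate n / (π * M) - round (zetaOrdinate n / (π * M))| ≤ η then
      q * Real.sqrt (M / zetaOrdinate n) else 0) with hE
  have hcoreM := hcore M (by omega) θ hθ0 hθ1 ((M : ℝ) ^ 2) hT₂lo hT₂ E (fun n hn ↦ hEM hEven n hn)
  have herr := error_sum_le hA0 hA hM hT₂lo hη0 hη2 (p := c * (1 + Real.log M) / Real.sqrt M) (q := q) E
    (fun n _ ↦ ⟨by rw [hE]; positivity, le_rfl⟩)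
  have hp2 : (c * (1 + Real.log M) / Real.sqrt M) ^ 2 = c ^ 2 * (1 + Real.log (M : ℝ)) ^ 2 / M := by
    rw [div_pow, mul_pow, Real.sq_sqrt hMpos.le]
  rw [hp2] at herr
  -- (i) main term
  have hY : (1 + Real.log ((M : ℝ) ^ 2)) ^ 4 ≤ 16 * ((1 + Real.log (M : ℝ)) ^ 4 / M * M) := by
    rw [hlogM2, div_mul_cancel₀ _ hMpos.ne']
    have : 1 + 2 * Real.log (M : ℝ) ≤ 2 * (1 + Real.log M) := by linarith
    calc (1 + 2 * Real.log (M : ℝ)) ^ 4 ≤ (2 * (1 + Real.log M)) ^ 4 := pow_le_pow_left₀ (by linarith) this 4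
      _ = 16 * (1 + Real.log (M : ℝ)) ^ 4 := by ring
  have hi := arith_main hθ1 hθε hLM hC₁ hC₂ hMpos (by positivity) hY
  -- (ii) error term
  have hii := arith_err (Serr := (M : ℝ) * ∑ n ∈ Finset.Ico (zetaZeroCount (4 * ((M / 2 : ℕ) : ℝ)))
      (zetaZeroCount ((M : ℝ) ^ 2)), E n ^ 2 / zetaOrdinate n ^ 2)
    ht0 hA0 hM1 hL₁1 (mul_Gtail_le hM) hlogQ hη0.le hηε herr
  -- (iii) high bands
  have hiii := arith_hb hA0 (show 2 ≤ M by omega)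
  -- combine
  have hconst : 576 * B₀ + 2 * C₁ + ε / 4 + 1 ≤ ε / 2 * Real.log M := by
    have := (div_le_iff₀ (by positivity : (0 : ℝ) < ε / 2)).1 hlogM'
    linarith
  have hKexp : 32 * C₂ * ((1 + Real.log (M : ℝ)) ^ 4 / M) +
      (50 * t * c ^ 2 + 4 * t * (q ^ 2 * A)) * ((1 + Real.log (M : ℝ)) ^ 4 / M) +
      6912 * A * ((1 + Real.log (M : ℝ)) ^ 4 / M) = K * ((1 + Real.log (M : ℝ)) ^ 4 / M) := by
    rw [hK]; ring
  have hsub : ε / 4 * (1 + Real.log (M : ℝ) - 1) = ε / 4 * Real.log M := by ring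
  rw [hsub] at hii
  linarith only [hcoreM, hi, hii, hiii, hconst, hKexp, hjM]

end Summit.RiemannHypothesis.RiemannHypothesis.Theorems.EtaLeadingQuarter.Zeros

end
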